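import Mathlib.Analysis.Calculus.ContDiff.Bounds
import Literature.Analysis.FluidPDE.OnsagerBDSVStationaryPhaseIBP
import HarnessLib

/-!
# BDSV stationary phase, III: derivative bounds for `Lⁿ a`

Buckmaster–De Lellis–Székelyhidi–Vicol 2019, App. C, Prop. C.2 (C.1) / Daneri–Székelyhidi 2017,
Lemma 2.2 (i): after `N` integrations by parts (`OnsagerBDSVStationaryPhaseIBP.lean`) it remains
to bound `sup |Lᴺ a|`, `L b = div(b F)`, `F = ∇φ/|∇φ|²` ("again by induction …
`[a_N ∇φ/|∇φ|²]_s ≤ C([a_j]_{N-j+s} + ‖a_j‖₀[∇φ]_{N-j+s})`"). This file provides the calculus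
behind that induction, in the GEOMETRIC bookkeeping `‖Dˢ·‖ ≤ X γˢ` into which the interpolation
inequality (A.3) (`LandauKolmogorov.lean`) puts all sup-norm levels:

* `BDSV.norm_iteratedFDeriv_lift_ibpOp_le` — one application of `L`: if `‖Dˡ b̃‖ ≤ X γˡ`
  (`l ≤ i+1`) and `‖Dˢ F̃ⱼ‖ ≤ Y γˢ` (`s ≤ i+1`) then `‖Dⁱ(L b)∼‖ ≤ 3·2^{i+1} X Y γ^{i+1}`
  (Leibniz, Mathlib `norm_iteratedFDeriv_mul_le`);
* `BDSV.norm_iteratedFDeriv_lift_iterate_ibpOp_le` — the induction on `n`: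
  `‖Dⁱ(Lⁿ a)∼‖ ≤ A (3·2ᴺ Y)ⁿ γ^{n+i}` for `n + i ≤ N`;
* `BDSV.norm_iteratedFDeriv_lift_dirVec_le`, `BDSV.exists_bound_iteratedFDerivWithin_recipVec`,
  `BDSV.norm_iteratedFDeriv_recipVec_comp_le`, `BDSV.norm_iteratedFDeriv_lift_ibpField_le` — the
  bounds for the field `F = (2π|m|)⁻¹ recipVec ∘ dirVec`: the derivatives of `v ↦ v/|v|²` are
  bounded on the compact annulus `Ĉ⁻¹ ≤ |v| ≤ Ĉ` by a constant `C_G(Ĉ, N)`, and the composition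
  with the direction field is controlled by Mathlib's Faà di Bruno bound
  `norm_iteratedFDerivWithin_comp_le`.

The assembly of (C.1) is `OnsagerBDSVStationaryPhaseProofs.lean`.

## References

* T. Buckmaster, C. De Lellis, L. Székelyhidi Jr., V. Vicol, *Onsager's conjecture for admissible
  weak solutions*, CPAM 72 (2019) = arXiv:1701.08678, App. C, Prop. C.2 (C.1); App. A (A.1)–(A.4).
  [`BuckmasterEtAl2018`]
* S. Daneri, L. Székelyhidi Jr., *Non-uniqueness and h-principle for Hölder-continuous weak
  solutions of the Euler equations*, ARMA 224 (2017) = arXiv:1603.09714, Lemma 2.2, proof.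
  [`DaneriSzekelyhidi2017`]
-/

noncomputable section

open Set
open scoped NNReal ENNReal ContDiff InnerProductSpace Nat

namespace Literature.Analysis.FluidPDE

namespace BDSV

open FunctionSpaces FunctionSpaces.Torus

/-- The flat three-torus `T³ = (ℝ/ℤ)³`, local notation. -/
local notation "𝕋³" => UnitAddTorus (Fin 3)

/-- Euclidean `ℝ³`, local notation. -/
local notation "ℝ³" => EuclideanSpace ℝ (Fin 3)

/-! ## Two elementary calculus bounds on `ℝ³` -/

section Calculus

/-- `‖Dⁱ(∂ⱼ p)‖ ≤ ‖Dⁱ⁺¹ p‖` for smooth `p : ℝ³ → ℝ` (`∂ⱼ p = Dp · eⱼ`, `|eⱼ| = 1`). [folklore] -/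
theorem norm_iteratedFDeriv_fderiv_apply_single_le {p : ℝ³ → ℝ} (hp : ContDiff ℝ ∞ p) (i : ℕ)
    (j : Fin 3) (y : ℝ³) :
    ‖iteratedFDeriv ℝ i (fun z => fderiv ℝ p z (EuclideanSpace.single j (1 : ℝ))) y‖ ≤
      ‖iteratedFDeriv ℝ (i + 1) p y‖ := by
  have hfd : ContDiff ℝ i (fderiv ℝ p) := hp.fderiv_right (by exact_mod_cast le_top)
  have h := norm_iteratedFDeriv_clm_apply_const (c := EuclideanSpace.single j (1 : ℝ))
    (hfd.contDiffAt (x := y)) le_rfl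
  rw [PiLp.norm_single, norm_one, one_mul, norm_iteratedFDeriv_fderiv] at h
  exact h

/-- `(α + ρ)ᴺ ≤ 2ᴺ (αᴺ + ρᴺ)` for `α, ρ ≥ 0`. [folklore] -/
theorem add_pow_le_two_pow_mul_add_pow {α ρ : ℝ} (hα : 0 ≤ α) (hρ : 0 ≤ ρ) (N : ℕ) :
    (α + ρ) ^ N ≤ 2 ^ N * (α ^ N + ρ ^ N) := by
  rcases le_total α ρ with h | h
  · calc (α + ρ) ^ N ≤ (2 * ρ) ^ N := pow_le_pow_left₀ (by positivity) (by linarith) N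
      _ = 2 ^ N * ρ ^ N := mul_pow _ _ _
      _ ≤ 2 ^ N * (α ^ N + ρ ^ N) := by gcongr; linarith [pow_nonneg hα N]
  · calc (α + ρ) ^ N ≤ (2 * α) ^ N := pow_le_pow_left₀ (by positivity) (by linarith) N
      _ = 2 ^ N * α ^ N := mul_pow _ _ _
      _ ≤ 2 ^ N * (α ^ N + ρ ^ N) := by gcongr; linarith [pow_nonneg hρ N]

end Calculus

/-! ## One application of `L`, and the induction on `n` -/

section Step

variable {Ĉ : ℝ} {D : 𝕋³ → ℝ³} {m : Fin 3 → ℤ}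

/-- **One application of `L` in geometric bookkeeping.** If `‖Dˡ(b∘proj)‖ ≤ X γˡ` for
`l ≤ i + 1` and `‖Dˢ(Fⱼ∘proj)‖ ≤ Y γˢ` for `s ≤ i + 1` (all `j`), then
`‖Dⁱ((L b)∘proj)(y)‖ ≤ 3 · 2^{i+1} X Y γ^{i+1}`: `(Lb)∘proj = ∑ⱼ ∂ⱼ(b̃ F̃ⱼ)`, `‖Dⁱ∂ⱼ·‖ ≤ ‖Dⁱ⁺¹·‖`,
Leibniz `‖Dⁱ⁺¹(b̃F̃ⱼ)‖ ≤ ∑ₗ C(i+1,l) ‖Dˡb̃‖ ‖D^{i+1-l}F̃ⱼ‖`, and `∑ₗ C(i+1,l) = 2^{i+1}`.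
[cite: DaneriSzekelyhidi2017, Lemma 2.2 (proof)] -/
theorem norm_iteratedFDeriv_lift_ibpOp_le (hĈ : 1 ≤ Ĉ) (hD : IsSmooth D)
    (hND : IsNondegenerateDisplacement Ĉ D) (hm : m ≠ 0) {b : 𝕋³ → ℝ} (hb : IsSmooth b) {i : ℕ}
    {X Y γ : ℝ} (hX : 0 ≤ X) (hγ : 0 ≤ γ)
    (hbX : ∀ l ≤ i + 1, ∀ y, ‖iteratedFDeriv ℝ l (lift b) y‖ ≤ X * γ ^ l)
    (hFY : ∀ j : Fin 3, ∀ s ≤ i + 1, ∀ y, ‖iteratedFDeriv ℝ s (lift (ibpField m D j)) y‖ ≤ Y * γ ^ s)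
    (y : ℝ³) :
    ‖iteratedFDeriv ℝ i (lift (ibpOp m D b)) y‖ ≤ 3 * 2 ^ (i + 1) * X * Y * γ ^ (i + 1) := by
  have hFs : ∀ j, ContDiff ℝ ∞ (lift (ibpField m D j)) := fun j => isSmooth_ibpField hĈ hD hND hm j
  set p : Fin 3 → ℝ³ → ℝ := fun j z => lift b z * lift (ibpField m D j) z with hp
  have hps : ∀ j, ContDiff ℝ ∞ (p j) := fun j => ContDiff.mul hb (hFs j)
  set f : Fin 3 → ℝ³ → ℝ := fun j z => fderiv ℝ (p j) z (EuclideanSpace.single j (1 : ℝ)) with hf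
  have hfs : ∀ j, ContDiff ℝ i (f j) := fun j =>
    ((hps j).fderiv_right (by exact_mod_cast le_top)).clm_apply contDiff_const
  have hlift : lift (ibpOp m D b) = fun z => ∑ j ∈ Finset.univ, f j z := lift_ibpOp hĈ hD hND hm hb
  -- each term: Leibniz
  have hterm : ∀ j, ‖iteratedFDeriv ℝ i (f j) y‖ ≤ 2 ^ (i + 1) * X * Y * γ ^ (i + 1) := by
    intro j
    refine (norm_iteratedFDeriv_fderiv_apply_single_le (hps j) i j y).trans ?_
    have hL := norm_iteratedFDeriv_mul_le (n := i + 1) (hb : ContDiff ℝ ∞ (lift b)) (hFs j) y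
      (by exact_mod_cast le_top)
    refine hL.trans ?_
    have hbound : ∀ l ∈ Finset.range (i + 1 + 1),
        ((i + 1).choose l : ℝ) * ‖iteratedFDeriv ℝ l (lift b) y‖ *
          ‖iteratedFDeriv ℝ (i + 1 - l) (lift (ibpField m D j)) y‖ ≤
          ((i + 1).choose l : ℝ) * (X * Y * γ ^ (i + 1)) := by
      intro l hl
      have hl' : l ≤ i + 1 := Nat.lt_succ_iff.1 (Finset.mem_range.1 hl)
      have h1 := hbX l hl' y
      have h2 := hFY j (i + 1 - l) (Nat.sub_le _ _) y
      have hpow : γ ^ l * γ ^ (i + 1 - l) = γ ^ (i + 1) := by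
        rw [← pow_add, Nat.add_sub_cancel' hl']
      rw [mul_assoc]
      refine mul_le_mul_of_nonneg_left ?_ (Nat.cast_nonneg _)
      calc ‖iteratedFDeriv ℝ l (lift b) y‖ * ‖iteratedFDeriv ℝ (i + 1 - l) (lift (ibpField m D j)) y‖
          ≤ (X * γ ^ l) * (Y * γ ^ (i + 1 - l)) :=
            mul_le_mul h1 h2 (norm_nonneg _) (by positivity)
        _ = X * Y * γ ^ (i + 1) := by rw [← hpow]; ring
    refine (Finset.sum_le_sum hbound).trans (le_of_eq ?_)
    rw [← Finset.sum_mul]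
    have hchoose : ∑ l ∈ Finset.range (i + 1 + 1), ((i + 1).choose l : ℝ) = 2 ^ (i + 1) := by
      exact_mod_cast Nat.sum_range_choose (i + 1)
    rw [hchoose]; ring
  -- sum over `j`
  rw [hlift, iteratedFDeriv_sum fun j _ => hfs j, Finset.sum_apply]
  calc ‖∑ j, iteratedFDeriv ℝ i (f j) y‖ ≤ ∑ j, ‖iteratedFDeriv ℝ i (f j) y‖ := norm_sum_le _ _
    _ ≤ ∑ _j : Fin 3, 2 ^ (i + 1) * X * Y * γ ^ (i + 1) := Finset.sum_le_sum fun j _ => hterm j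
    _ = 3 * 2 ^ (i + 1) * X * Y * γ ^ (i + 1) := by
        simp [Finset.sum_const, Finset.card_univ]; ring

/-- **The induction on `n`** (Daneri–Székelyhidi: "again by induction"): if `‖Dˢ(a∘proj)‖ ≤ A γˢ`
and `‖Dˢ(Fⱼ∘proj)‖ ≤ Y γˢ` for all `s ≤ N`, then for `n + i ≤ N`,
`‖Dⁱ((Lⁿ a)∘proj)‖ ≤ A (3·2ᴺ Y)ⁿ γ^{n+i}`. [cite: DaneriSzekelyhidi2017, Lemma 2.2 (proof)] -/
theorem norm_iteratedFDeriv_lift_iterate_ibpOp_le (hĈ : 1 ≤ Ĉ) (hD : IsSmooth D)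
    (hND : IsNondegenerateDisplacement Ĉ D) (hm : m ≠ 0) {a : 𝕋³ → ℝ} (ha : IsSmooth a) (N : ℕ)
    {A Y γ : ℝ} (hA : 0 ≤ A) (hY : 0 ≤ Y) (hγ : 0 ≤ γ)
    (haA : ∀ s ≤ N, ∀ y, ‖iteratedFDeriv ℝ s (lift a) y‖ ≤ A * γ ^ s)
    (hFY : ∀ j : Fin 3, ∀ s ≤ N, ∀ y, ‖iteratedFDeriv ℝ s (lift (ibpField m D j)) y‖ ≤ Y * γ ^ s) :
    ∀ n i : ℕ, n + i ≤ N → ∀ y,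
      ‖iteratedFDeriv ℝ i (lift ((ibpOp m D)^[n] a)) y‖ ≤ A * (3 * 2 ^ N * Y) ^ n * γ ^ (n + i) := by
  intro n
  induction n with
  | zero =>
      intro i hi y
      simpa using haA i (by simpa using hi) y
  | succ n ih =>
      intro i hi y
      rw [Function.iterate_succ_apply']
      have hbs : IsSmooth ((ibpOp m D)^[n] a) := isSmooth_iterate_ibpOp hĈ hD hND hm ha n
      set X : ℝ := A * (3 * 2 ^ N * Y) ^ n * γ ^ n with hXdef
      have hX0 : 0 ≤ X := by positivity
      have hbX : ∀ l ≤ i + 1, ∀ y, ‖iteratedFDeriv ℝ l (lift ((ibpOp m D)^[n] a)) y‖ ≤ X * γ ^ l := by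
        intro l hl y
        have h := ih l (by omega) y
        rwa [pow_add, ← mul_assoc] at h
      have hFY' : ∀ j : Fin 3, ∀ s ≤ i + 1, ∀ y,
          ‖iteratedFDeriv ℝ s (lift (ibpField m D j)) y‖ ≤ Y * γ ^ s :=
        fun j s hs y => hFY j s (by omega) y
      have h := norm_iteratedFDeriv_lift_ibpOp_le hĈ hD hND hm hbs hX0 hγ hbX hFY' y
      refine h.trans ?_
      have h2 : (2 : ℝ) ^ (i + 1) ≤ 2 ^ N := pow_le_pow_right₀ (by norm_num) (by omega)
      have hγp : 0 ≤ γ ^ (i + 1) := pow_nonneg hγ _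
      calc 3 * 2 ^ (i + 1) * X * Y * γ ^ (i + 1) ≤ 3 * 2 ^ N * X * Y * γ ^ (i + 1) := by
            gcongr
        _ = A * (3 * 2 ^ N * Y) ^ (n + 1) * γ ^ (n + 1 + i) := by
            rw [hXdef]; ring

end Step

/-! ## Bounds for the field `F = (2π|m|)⁻¹ recipVec ∘ dirVec` -/

section Field

variable {Ĉ : ℝ} {D : 𝕋³ → ℝ³} {m : Fin 3 → ℤ}

/-- Derivatives of the lifted direction field: `‖Dˢ(dirVec∘proj)(y)‖ ≤ ‖Dˢ⁺¹(D∘proj)(y)‖`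
for `s ≥ 1` (`dirVec∘proj = m̂ + (∇D̃)ᵀm̂`, `|m̂| = 1`, `‖T ↦ Tᵀm̂‖ ≤ |m̂|`). [folklore] -/
theorem norm_iteratedFDeriv_lift_dirVec_le (hD : IsSmooth D) (hm : m ≠ 0) {s : ℕ} (hs : 1 ≤ s)
    (y : ℝ³) :
    ‖iteratedFDeriv ℝ s (lift (dirVec m D)) y‖ ≤ ‖iteratedFDeriv ℝ (s + 1) (lift D) y‖ := by
  have hT : ContDiff ℝ ∞ (fderiv ℝ (lift D)) := hD.fderiv_right le_rfl
  have hg : ContDiff ℝ ∞ (adjApply (unitFreq m) ∘ fderiv ℝ (lift D)) :=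
    (adjApply (unitFreq m)).contDiff.comp hT
  have hsplit : lift (dirVec m D) = (fun _ => unitFreq m) + (adjApply (unitFreq m) ∘ fderiv ℝ (lift D)) := by
    rw [lift_dirVec]; rfl
  rw [hsplit, iteratedFDeriv_add_apply contDiff_const.contDiffAt
    (hg.of_le (by exact_mod_cast le_top)).contDiffAt,
    iteratedFDeriv_const_of_ne (by omega) (unitFreq m), Pi.zero_apply, zero_add]
  calc ‖iteratedFDeriv ℝ s (adjApply (unitFreq m) ∘ fderiv ℝ (lift D)) y‖
      ≤ ‖adjApply (unitFreq m)‖ * ‖iteratedFDeriv ℝ s (fderiv ℝ (lift D)) y‖ :=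
        (adjApply (unitFreq m)).norm_iteratedFDeriv_comp_left (hT.contDiffAt (x := y))
          (by exact_mod_cast le_top)
    _ ≤ 1 * ‖iteratedFDeriv ℝ (s + 1) (lift D) y‖ := by
        rw [norm_iteratedFDeriv_fderiv]
        refine mul_le_mul_of_nonneg_right ?_ (norm_nonneg _)
        have := opNorm_adjApply_le (unitFreq m)
        rwa [norm_unitFreq hm] at this
    _ = _ := one_mul _

/-- **The constant `C_G(Ĉ, N)`**: the derivatives of `v ↦ v/|v|²` of order `≤ N` (taken within
the open set `{v ≠ 0}`) are bounded on the compact annulus `Ĉ⁻¹ ≤ |v| ≤ Ĉ` (`Ĉ ≥ 1`), by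
continuity. [folklore] -/
theorem exists_bound_iteratedFDerivWithin_recipVec (hĈ : 1 ≤ Ĉ) (N : ℕ) :
    ∃ C : ℝ, 0 ≤ C ∧ ∀ v : ℝ³, Ĉ⁻¹ ≤ ‖v‖ → ‖v‖ ≤ Ĉ → ∀ i ≤ N,
      ‖iteratedFDerivWithin ℝ i recipVec {v : ℝ³ | v ≠ 0} v‖ ≤ C := by
  have hC : 0 < Ĉ := lt_of_lt_of_le one_pos hĈ
  set K : Set ℝ³ := {v | Ĉ⁻¹ ≤ ‖v‖ ∧ ‖v‖ ≤ Ĉ} with hK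
  have hKc : IsCompact K := by
    refine Metric.isCompact_of_isClosed_isBounded ?_ ?_
    · have : K = (fun v : ℝ³ => ‖v‖) ⁻¹' Icc Ĉ⁻¹ Ĉ := by ext v; simp [hK]
      rw [this]
      exact isClosed_Icc.preimage continuous_norm
    · refine (Metric.isBounded_closedBall (x := (0 : ℝ³)) (r := Ĉ)).subset fun v hv => ?_
      simpa [hK] using hv.2
  have hKsub : K ⊆ {v : ℝ³ | v ≠ 0} := by
    intro v hv h0
    have : Ĉ⁻¹ ≤ 0 := by simpa [h0] using hv.1
    exact absurd this (not_le.2 (inv_pos.2 hC))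
  have hopen : IsOpen {v : ℝ³ | v ≠ 0} := isOpen_ne
  have hcont : ∀ i : ℕ, ContinuousOn (iteratedFDerivWithin ℝ i recipVec {v : ℝ³ | v ≠ 0}) K :=
    fun i => (contDiffOn_recipVec.continuousOn_iteratedFDerivWithin (by exact_mod_cast le_top)
      hopen.uniqueDiffOn).mono hKsub
  have hex : ∀ i : ℕ, ∃ C : ℝ, ∀ v ∈ K,
      ‖iteratedFDerivWithin ℝ i recipVec {v : ℝ³ | v ≠ 0} v‖ ≤ C :=
    fun i => hKc.exists_bound_of_continuousOn (hcont i)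
  choose C hCb using hex
  refine ⟨∑ i ∈ Finset.range (N + 1), |C i|, Finset.sum_nonneg fun i _ => abs_nonneg _, ?_⟩
  intro v hv1 hv2 i hi
  have hvK : v ∈ K := ⟨hv1, hv2⟩
  calc ‖iteratedFDerivWithin ℝ i recipVec {v : ℝ³ | v ≠ 0} v‖ ≤ C i := hCb i v hvK
    _ ≤ |C i| := le_abs_self _
    _ ≤ ∑ k ∈ Finset.range (N + 1), |C k| :=
        Finset.single_le_sum (f := fun k => |C k|) (fun _ _ => abs_nonneg _)
          (Finset.mem_range.2 (Nat.lt_succ_of_le hi))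

/-- **Composition bound** (Faà di Bruno, Mathlib `norm_iteratedFDerivWithin_comp_le`): if `u` is
smooth with values in the annulus `Ĉ⁻¹ ≤ |u| ≤ Ĉ` on which the derivatives of `v ↦ v/|v|²` of
order `≤ N` are bounded by `C_G`, and `‖Dⁱu‖ ≤ Duⁱ` for `1 ≤ i ≤ n`, then
`‖Dⁿ(recipVec ∘ u)‖ ≤ n! C_G Duⁿ` for `n ≤ N`. [cite: BuckmasterEtAl2018, App. A Prop. A.1 (A.4)] -/
theorem norm_iteratedFDeriv_recipVec_comp_le {u : ℝ³ → ℝ³} (hu : ContDiff ℝ ∞ u)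
    (hrange : ∀ y, Ĉ⁻¹ ≤ ‖u y‖ ∧ ‖u y‖ ≤ Ĉ) (hĈ : 1 ≤ Ĉ) {N : ℕ} {C_G : ℝ}
    (hCG : ∀ v : ℝ³, Ĉ⁻¹ ≤ ‖v‖ → ‖v‖ ≤ Ĉ → ∀ i ≤ N,
      ‖iteratedFDerivWithin ℝ i recipVec {v : ℝ³ | v ≠ 0} v‖ ≤ C_G)
    {n : ℕ} (hn : n ≤ N) {Du : ℝ} (hDu : ∀ i, 1 ≤ i → i ≤ n → ∀ y, ‖iteratedFDeriv ℝ i u y‖ ≤ Du ^ i)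
    (y : ℝ³) : ‖iteratedFDeriv ℝ n (recipVec ∘ u) y‖ ≤ n ! * C_G * Du ^ n := by
  have hC : 0 < Ĉ := lt_of_lt_of_le one_pos hĈ
  have hne : ∀ y, u y ≠ 0 := fun y h0 => by
    have := (hrange y).1
    rw [h0, norm_zero] at this
    exact absurd this (not_le.2 (inv_pos.2 hC))
  have hopen : IsOpen {v : ℝ³ | v ≠ 0} := isOpen_ne
  have h := norm_iteratedFDerivWithin_comp_le (g := recipVec) (f := u) (n := n) (s := univ)
    (t := {v : ℝ³ | v ≠ 0}) (x := y) (N := ((⊤ : ℕ∞) : ℕ∞ω)) contDiffOn_recipVec hu.contDiffOn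
    (by exact_mod_cast le_top) hopen.uniqueDiffOn uniqueDiffOn_univ (fun z _ => hne z) (mem_univ y)
    (C := C_G) (D := Du) (fun i hi => hCG (u y) (hrange y).1 (hrange y).2 i (hi.trans hn))
    (fun i h1 hi => by rw [iteratedFDerivWithin_univ]; exact hDu i h1 hi y)
  rwa [iteratedFDerivWithin_univ] at h

/-- The operator norm of a coordinate projection of `ℝ³` is at most one. [folklore] -/
theorem opNorm_euclidean_proj_le (j : Fin 3) : ‖(EuclideanSpace.proj j : ℝ³ →L[ℝ] ℝ)‖ ≤ 1 :=
  ContinuousLinearMap.opNorm_le_bound _ zero_le_one fun v => by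
    rw [one_mul]; exact PiLp.norm_apply_le v j

/-- Derivatives of the lifted field: `‖Dⁿ(Fⱼ∘proj)(y)‖ ≤ (2π|m|)⁻¹ ‖Dⁿ(recipVec ∘ dirVec∘proj)(y)‖`.
[folklore] -/
theorem norm_iteratedFDeriv_lift_ibpField_le (hĈ : 1 ≤ Ĉ) (hD : IsSmooth D)
    (hND : IsNondegenerateDisplacement Ĉ D) (hm : m ≠ 0) (j : Fin 3) (n : ℕ) (y : ℝ³) :
    ‖iteratedFDeriv ℝ n (lift (ibpField m D j)) y‖ ≤
      (2 * Real.pi * ‖latticeVec m‖)⁻¹ * ‖iteratedFDeriv ℝ n (recipVec ∘ lift (dirVec m D)) y‖ := by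
  have hc0 : 0 < 2 * Real.pi * ‖latticeVec m‖ := by have := norm_latticeVec_pos hm; positivity
  have hcomp : ContDiff ℝ ∞ (recipVec ∘ lift (dirVec m D)) :=
    contDiffOn_recipVec.comp_contDiff (isSmooth_dirVec m hD) fun y =>
      dirVec_ne_zero hĈ hND hm (proj y)
  have hgs : ContDiff ℝ ∞
      ((EuclideanSpace.proj j : ℝ³ →L[ℝ] ℝ) ∘ (recipVec ∘ lift (dirVec m D))) :=
    (EuclideanSpace.proj j : ℝ³ →L[ℝ] ℝ).contDiff.comp hcomp
  have hfun : lift (ibpField m D j) = (2 * Real.pi * ‖latticeVec m‖)⁻¹ •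
      ((EuclideanSpace.proj j : ℝ³ →L[ℝ] ℝ) ∘ (recipVec ∘ lift (dirVec m D))) := by
    funext z
    simp only [Pi.smul_apply, smul_eq_mul, Function.comp_apply, lift_ibpField, PiLp.proj_apply]
  rw [hfun, iteratedFDeriv_const_smul_apply (hgs.of_le (by exact_mod_cast le_top)).contDiffAt,
    norm_smul, norm_inv, Real.norm_eq_abs, abs_of_pos hc0]
  refine mul_le_mul_of_nonneg_left ?_ (inv_nonneg.2 hc0.le)
  calc ‖iteratedFDeriv ℝ n ((EuclideanSpace.proj j : ℝ³ →L[ℝ] ℝ) ∘ (recipVec ∘ lift (dirVec m D))) y‖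
      ≤ ‖(EuclideanSpace.proj j : ℝ³ →L[ℝ] ℝ)‖ * ‖iteratedFDeriv ℝ n (recipVec ∘ lift (dirVec m D)) y‖ :=
        (EuclideanSpace.proj j : ℝ³ →L[ℝ] ℝ).norm_iteratedFDeriv_comp_left (hcomp.contDiffAt (x := y))
          (by exact_mod_cast le_top)
    _ ≤ 1 * ‖iteratedFDeriv ℝ n (recipVec ∘ lift (dirVec m D)) y‖ :=
        mul_le_mul_of_nonneg_right (opNorm_euclidean_proj_le j) (norm_nonneg _)
    _ = _ := one_mul _

end Field

/-! ## The sup bound for `Lᴺ a` -/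

section SupBound

variable {Ĉ : ℝ} {D : 𝕋³ → ℝ³} {m : Fin 3 → ℤ}

/-- **The bound for `sup |Lᴺ a|` in geometric bookkeeping.** Suppose `‖Dˢ(a∘proj)‖ ≤ A αˢ` and
`‖Dˢ(∇D̃)‖ ≤ Q ρˢ` for `s ≤ N` (`A, α ≥ 0`, `Q, ρ ≥ 1`; this is what the interpolation
inequality (A.3) provides), and let `C_G` bound the derivatives of order `≤ N` of `v ↦ v/|v|²` on
the annulus `Ĉ⁻¹ ≤ |v| ≤ Ĉ`. Then
`|Lᴺ a| ≤ A (3·2ᴺ Y)ᴺ (α + ρ)ᴺ` with `Y = (2π|m|)⁻¹ N! C_G Qᴺ`: the field satisfies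
`‖Dˢ F̃ⱼ‖ ≤ Y ρˢ` (composition bound with `‖Dⁱ(dirVec∘proj)‖ ≤ Qρⁱ ≤ (Qρ)ⁱ`), and the
induction on `n` applies with `γ = α + ρ`. [cite: DaneriSzekelyhidi2017, Lemma 2.2 (proof)] -/
theorem abs_iterate_ibpOp_le (hĈ : 1 ≤ Ĉ) (hD : IsSmooth D) (hND : IsNondegenerateDisplacement Ĉ D)
    (hm : m ≠ 0) {a : 𝕋³ → ℝ} (ha : IsSmooth a) {N : ℕ} {C_G : ℝ} (hCG0 : 0 ≤ C_G)
    (hCG : ∀ v : ℝ³, Ĉ⁻¹ ≤ ‖v‖ → ‖v‖ ≤ Ĉ → ∀ i ≤ N,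
      ‖iteratedFDerivWithin ℝ i recipVec {v : ℝ³ | v ≠ 0} v‖ ≤ C_G)
    {A α Q ρ : ℝ} (hA : 0 ≤ A) (hα : 0 ≤ α) (hQ : 1 ≤ Q) (hρ : 1 ≤ ρ)
    (haA : ∀ s ≤ N, ∀ y, ‖iteratedFDeriv ℝ s (lift a) y‖ ≤ A * α ^ s)
    (hT : ∀ s ≤ N, ∀ y, ‖iteratedFDeriv ℝ s (fderiv ℝ (lift D)) y‖ ≤ Q * ρ ^ s) (x : 𝕋³) :
    |(ibpOp m D)^[N] a x| ≤
      A * (3 * 2 ^ N * ((2 * Real.pi * ‖latticeVec m‖)⁻¹ * (N ! * C_G * Q ^ N))) ^ N *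
        (α + ρ) ^ N := by
  set c : ℝ := 2 * Real.pi * ‖latticeVec m‖ with hc
  have hc0 : 0 < c := by have := norm_latticeVec_pos hm; positivity
  set Y : ℝ := c⁻¹ * (N ! * C_G * Q ^ N) with hYdef
  have hQ0 : 0 ≤ Q := zero_le_one.trans hQ
  have hρ0 : 0 ≤ ρ := zero_le_one.trans hρ
  have hY0 : 0 ≤ Y := by positivity
  set γ : ℝ := α + ρ with hγ
  have hργ : ρ ≤ γ := by rw [hγ]; linarith
  have hαγ : α ≤ γ := by rw [hγ]; linarith
  have hγ0 : 0 ≤ γ := hρ0.trans hργ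
  -- derivative bounds for the lifted direction field
  have hu : ContDiff ℝ ∞ (lift (dirVec m D)) := isSmooth_dirVec m hD
  have hrange : ∀ y, Ĉ⁻¹ ≤ ‖lift (dirVec m D) y‖ ∧ ‖lift (dirVec m D) y‖ ≤ Ĉ := fun y =>
    ⟨inv_le_norm_dirVec hĈ hND hm (proj y), norm_dirVec_le hND hm (proj y)⟩
  have hDu : ∀ i, 1 ≤ i → i ≤ N → ∀ y, ‖iteratedFDeriv ℝ i (lift (dirVec m D)) y‖ ≤ (Q * ρ) ^ i := by
    intro i h1 hi y
    calc ‖iteratedFDeriv ℝ i (lift (dirVec m D)) y‖ ≤ ‖iteratedFDeriv ℝ (i + 1) (lift D) y‖ :=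
          norm_iteratedFDeriv_lift_dirVec_le hD hm h1 y
      _ = ‖iteratedFDeriv ℝ i (fderiv ℝ (lift D)) y‖ := by rw [norm_iteratedFDeriv_fderiv]
      _ ≤ Q * ρ ^ i := hT i hi y
      _ ≤ Q ^ i * ρ ^ i := by
          gcongr
          calc Q = Q ^ 1 := (pow_one _).symm
            _ ≤ Q ^ i := pow_le_pow_right₀ hQ h1
      _ = (Q * ρ) ^ i := by rw [← mul_pow]
  -- derivative bounds for the lifted field
  have hF : ∀ j : Fin 3, ∀ s ≤ N, ∀ y, ‖iteratedFDeriv ℝ s (lift (ibpField m D j)) y‖ ≤ Y * γ ^ s := by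
    intro j s hs y
    have hcomp := norm_iteratedFDeriv_recipVec_comp_le hu hrange hĈ hCG hs
      (fun i h1 hi y => hDu i h1 (hi.trans hs) y) y
    have hsN : (s ! : ℝ) ≤ N ! := by exact_mod_cast Nat.factorial_le hs
    calc ‖iteratedFDeriv ℝ s (lift (ibpField m D j)) y‖
        ≤ c⁻¹ * ‖iteratedFDeriv ℝ s (recipVec ∘ lift (dirVec m D)) y‖ :=
          norm_iteratedFDeriv_lift_ibpField_le hĈ hD hND hm j s y
      _ ≤ c⁻¹ * (s ! * C_G * (Q * ρ) ^ s) := by gcongr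
      _ = c⁻¹ * (s ! * C_G * Q ^ s) * ρ ^ s := by rw [mul_pow]; ring
      _ ≤ c⁻¹ * (N ! * C_G * Q ^ N) * γ ^ s := by
          have h3 : Q ^ s ≤ Q ^ N := pow_le_pow_right₀ hQ hs
          have h4 : ρ ^ s ≤ γ ^ s := pow_le_pow_left₀ hρ0 hργ s
          have h5 : 0 ≤ c⁻¹ := inv_nonneg.2 hc0.le
          have h6 : (0 : ℝ) ≤ Q ^ s := by positivity
          gcongr
      _ = Y * γ ^ s := by rw [hYdef]
  -- bounds for `a` with `γ` in place of `α`
  have haγ : ∀ s ≤ N, ∀ y, ‖iteratedFDeriv ℝ s (lift a) y‖ ≤ A * γ ^ s := fun s hs y =>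
    (haA s hs y).trans (mul_le_mul_of_nonneg_left (pow_le_pow_left₀ hα hαγ s) hA)
  -- the induction at `n = N`, `i = 0`
  obtain ⟨y, rfl⟩ := proj_surjective x
  have h := norm_iteratedFDeriv_lift_iterate_ibpOp_le hĈ hD hND hm ha N hA hY0 hγ0 haγ hF N 0
    (by simp) y
  rw [norm_iteratedFDeriv_zero, add_zero, Torus.lift_apply] at h
  rw [← Real.norm_eq_abs]
  exact h

end SupBound

end BDSV

end Literature.Analysis.FluidPDE
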